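import Summits.HodgeConjecture.HodgeConjecture.Theorems.F0P2cSocketC              -- ★ p01 (g3): `cohFinComponentIsThetaAdm_of_CE` (⊇ ★ SocketCOfStubs, ★ CEOfRung2 + GL∕LW∕LR∕LTpu closers, ★ E3OfRung2, ★ SocketD, ★ U2′∕U1′ heads)
import Summits.HodgeConjecture.HodgeConjecture.Theorems.F0P2gPKOfRung3             -- ★ p816062 p01 (g5): `stubPK_of_PKPi` (PK ⟸ PKΠ; KSP ★ p811895, NSI ★ p813978 inside)
import Summits.HodgeConjecture.HodgeConjecture.Theorems.HCCMUnconditionalH413OfF0  -- ★ F0P4-p07: `H413_of_F0HdictE_F0HJ3a` (socket 27457 ★ p814762 discharged); imports the route file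
import Summits.HodgeConjecture.HodgeConjecture.Theorems.F0P2jPKPiOfLetters          -- ★ p820351 A-p17 (g15): `pkPi_of_letters (hS2 : ‹C2♯ text›) (hGR) (hD7) : ‹PKΠ›` (rung-4 chain, Lines-free)
import Literature.NumberTheory.Rogawski1990.CohDiscreteMemXiFamilyArchPinned                -- ★ p820996 F0-typ3 (g6): the S2♯ LETTER `cohDiscrete_memXiFamily_archPinned` BY NAME (body ↔ A-p17's `hS2` ∕ desk's `C2SharpLetter`: `Iff.rfl`)
import HarnessLib

/-!
# Crux `H413` · programme P2 · SOCKET 27455 `F0HdictE` AND THE CRUX FROM EXACTLY THE FOUR P2 LETTERS S2♯ (= C2♯) + GR91N + D7α + E3♭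
# — the self-contained sibling of ★ `F0P2kHdictEOfLetters` (p820501: the same sockets modulo {PKΠ, E3♭}), kept in its own module for the 400-line cap

Cell hodgecm-mathlib (D-0151), FLOOR 0, crux item H413 = stmt-HodgeConjecture-24833; route support item `F0HdictE` = stmt-HodgeConjecture-27455 (programme P2).
Author F0P2-p01 (g6) (F0P2-plan (g6) ROW «HDICTE-OF-LETTERS» (4), GO 2026-08-31T10:22:32Z: «ED.2 after A-p17's PKΠ-OF-LETTERS ★ with `hS2 : ‹C2SharpLetter body›`»).
THEOREMS ONLY (no `def`, no instance, no local attribute, no notation, no named fact of our own, no `sorry`); kernel lane `--supports stmt-HodgeConjecture-24833 --as helper`; never imports a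
`Cruxes/…/Lines` module (O50-1) — the letter texts are PASTED VERBATIM.  HONEST LABEL: HC_CM is proved only modulo the printed citations until rung 0 closes; this file
adds no mathematics — it is the ONE kernel term exhibiting the route support decl `…Theses.HCCMUnconditional.F0HdictE` and the crux `…Theses.HCCMUnconditional.H413` as
functions of EXACTLY the four open letters of programme P2 (and, for the crux, P3's socket 27456), everything in-house plugged BY NAME:

* `hdictE_of_letters (hS2) (hGR) (hD7) (hE) : …Theses.HCCMUnconditional.F0HdictE` — the composition of ★ p820501 `F0P2kHdictEOfLetters.hdictE_of_PK_E3flat` INLINED (so that this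
  module does not import p820501): `delta F0HdictE HdictEType; exact ★ oscillatorTriple_dictionaryExistence_holds_of ★U1′ (★ p798914 stub_U2_…_of_Cadm_D (★ cohFinComponentIsThetaAdm_of_CE
  (★ p809975 stubCE_of_PK_GL_LW_LR_LTpu (★ p816062 stubPK_of_PKPi (★ p820351 pkPi_of_letters hS2 hGR hD7)) ★GL ★LW ★LR ★LTpu)) ★ p799091) (★ stubU4_of_E3flat hE)`;
* `H413_of_letters (hS2) (hGR) (hD7) (hE) (hJ3a : …Theses.HCCMUnconditional.F0HJ3a) : …Theses.HCCMUnconditional.H413` := ★ `HCCMUnconditionalH413OfF0.H413_of_F0HdictE_F0HJ3a` (27457 ★ inside).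

THE FOUR LETTERS (the floor-0 P2 census of record, RESIDUE-AUDIT `F0/P2/RESIDUE-AUDIT.F0P2p01g6.md` §C; in-house residue ∅):
* `hS2 : Rogawski1990.cohDiscrete_memXiFamily_archPinned` — the S2♯ LETTER BY NAME (★ p820996, F0-typ3 (g6); = conjunct (C2♯) of P3's T5 head = the desk's
  `C2SharpLetter` = the `hS2` text of ★ `pkPi_of_letters`, `Iff.rfl`): a cotangent, `Kc`-trivial discrete `P` of the definite CM inner form carrying an irreducible `(𝔤,K)`-token
  of degree-one type `δ = ±1` lies in the ξ-local family of some one-dimensional automorphic `ξ` of `H`, with `ξ_∞` cohomologically trivial at the archimedean recipe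
  `tOfArchType k` of every unitary type `k` of `μω` (print: Rogawski 1990 Thm. 13.3.6 (c), Thm. 14.6.4, Prop. 12.3.3, Prop. 15.2.1 (b)) — ENGINE, P3's T-kit at rung 0;
* `hGR : GR91Lemma512NonsplitAsPrinted` — PRINT ★ p818501 (print: Gelbart–Rogawski 1991 (5.1.1), Lem. 5.1.2 p. 466);
* `hD7 : xiEnvelope_nonsplit_isThetaType` — PRINT ★ p818350 (print: Rogawski 1990 Thm. 13.3.3, 13.3.6 (c), Prop. 13.1.3 (d); Gelbart–Rogawski 1991 Lem. 5.1.2, Prop. 5.2.2);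
* `hE` — E3♭ `F0P2E3ParityRecut.StubE3FlatAutomorphicParity` VERBATIM (E3 re-cut v1.1 :127 = (C)-line :324): automorphic occurrence ⇒ parity (print: Rogawski 1992 Thm 1.1) — ENGINE (E)-row.
Day X: each hypothesis becomes a one-token fold (`‹S2♯ export›_holds`, `GR91…_holds`, `xiEnvelope…_holds`, `‹E3♭›_holds`) and `F0HdictE_holds := hdictE_of_letters …` closes 27455
`--workitem stmt-HodgeConjecture-27455`.

S2♯ BY NAME: `hS2 : Literature.NumberTheory.Rogawski1990.cohDiscrete_memXiFamily_archPinned` (★ p820996, F0-typ3 (g6); its body is the `hS2` binder text of ★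
`F0P2jPKPiOfLetters.pkPi_of_letters` token for token — typ3's cert `CERT-S2sharp-vs-P2-C2SharpLetter-IffRfl` and ref1 r109∕r113 — so the application `pkPi_of_letters hS2` type-checks by
δ-unfolding the named `def`; no `(𝔤,K)` vocabulary, no local instance attribute and no letter text of S2♯ appear in THIS file).
TEXT CERTIFICATE (python, whitespace-normalised exact equality): `hE` == E3 re-cut a3adf85a :127 == (C)-line 9a8c3ffd :324 == ★ `F0P2kHdictEOfLetters.hdictE_of_PKPi_E3flat`'s `hE` == ★ `F0P2fE3OfRung2.stubU4_of_E3flat`'s `hE` — True.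

## References
* [Rogawski1990] J. Rogawski, Ann. of Math. Stud. 123 (1990): §12.3 Prop. 12.3.3; Thm. 13.3.1, 13.3.3, 13.3.6 (c); Thm. 14.6.4; Prop. 15.2.1 (b).  [Rogawski1992] Thm 1.1.
* [GelbartRogawski1991] S. Gelbart, J. Rogawski, Invent. Math. 105 (1991): Thm 5.1.1, (5.1.1), Lem. 5.1.2, Prop. 5.2.2.  [HarrisKudlaSweet1996] Thm 6.1.
* [Liu2021] Y. Liu, Camb. J. Math. 9 (2021): Prop. 4.13 and proof l. 2121–2146, Rem. 4.14, Def. 4.11–4.12.  [Li1992] Thm 2.1.  [Flath1979] Thm 3.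
-/

set_option autoImplicit false

-- the mandated namespace has the single-problem summit's repeated segment (`HodgeConjecture.HodgeConjecture`)
set_option linter.dupNamespace false

noncomputable section

namespace Summit.HodgeConjecture.HodgeConjecture.Cruxes.H413.F0P2kHdictEOfFourLetters

-- opens: exactly ★ `F0P2kHdictEOfLetters`'s (= ★ `F0P2cSocketC`'s), under which the pasted E3♭ text elaborates there
open NumberField MeasureTheory IsDedekindDomain
open scoped Matrix ComplexOrder
open Literature.NumberTheory Literature.NumberTheory.Automorphic Literature.NumberTheory.Automorphic.UnitaryGroup
open Literature.NumberTheory.Automorphic.UnitaryGroup.CotangentForms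
open Literature.NumberTheory.Automorphic.IdeleClassGroup
open Literature.NumberTheory.Automorphic.Liu2021 Literature.NumberTheory.Automorphic.Liu2021.Def411WeilCarriers
open Literature.NumberTheory.Automorphic.Liu2021.Def411WeilCarriersDoubling
open Literature.NumberTheory.GelbartRogawski1991 Literature.NumberTheory.GelbartRogawski1991.UnitaryDualPair
open Literature.NumberTheory.GelbartRogawski1991.UnitaryDualPair.WeilCoinv
open Literature.RepresentationTheory Literature.RepresentationTheory.Liu2021
open Literature.NumberTheory.Rogawski1990
open Summit.HodgeConjecture.CorCM.Transposition
open Summit.HodgeConjecture.HodgeConjecture.Cruxes.H413.SpectrumInterfaces (oscillatorTriple_dictionaryExistence_holds_of)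
open scoped TensorProduct
open Literature.NumberTheory
open Literature.RepresentationTheory
open NumberField.InfinitePlace
open Literature.NumberTheory.Automorphic.Liu2021.AppendixC
open Summit.HodgeConjecture.CorCM
open HodgeCM.Model HodgeCM.Model.LiuIndex HodgeCM.Model.TowerCarrier
open Summit.HodgeConjecture.CorCM.Model

set_option synthInstance.maxHeartbeats 400000 in
set_option maxHeartbeats 16000000 in
/-- **SOCKET 27455 `HCCMUnconditional.F0HdictE` BY NAME FROM EXACTLY THE FOUR P2 LETTERS** — S2♯ `cohDiscrete_memXiFamily_archPinned` (★ p820996) BY NAME, the PRINT letters U′-N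
`GR91Lemma512NonsplitAsPrinted` and D7α `xiEnvelope_nonsplit_isThetaType` BY NAME, and the ENGINE parity letter E3♭ VERBATIM — via ★ `F0P2jPKPiOfLetters.pkPi_of_letters`
(A-p17 (g15): GRD ★ p819573 over U′-N, witness ★ p819322, RIG∞ ★ p819114, LTY ★ p816375, CL ★ p799835 inside) and the composition of ★ p820501 `F0P2kHdictEOfLetters.hdictE_of_PK_E3flat` inlined (PK ⟸ PKΠ ★ p816062;
CE ⟸ PK ★ p809975; (C♭) ⟸ CE ★; U2′ ★ p798914; (D) ★ p799091; U1′ ★; U4 ⟸ E3♭ ★).  HC_CM is proved only modulo the printed citations until rung 0 closes.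
[cite: Rogawski1990, Thm. 13.3.6 (c), Thm. 14.6.4, Prop. 12.3.3, Prop. 15.2.1 (b)] [cite: GelbartRogawski1991, Thm 5.1.1, Lem 5.1.2, Prop. 5.2.2] [cite: Rogawski1992, Thm 1.1]
[cite: Liu2021, Prop. 4.13 and proof l. 2121–2146, Rem. 4.14] -/
theorem hdictE_of_letters
    (hS2 : Literature.NumberTheory.Rogawski1990.cohDiscrete_memXiFamily_archPinned)
    (hGR : Literature.NumberTheory.GelbartRogawski1991.GR91Lemma512NonsplitAsPrinted)
    (hD7 : Literature.NumberTheory.GelbartRogawski1991.xiEnvelope_nonsplit_isThetaType)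
    (hE :
      ∀ (L : Type) [Field L] [NumberField L] [IsCMField L] (ι : L →+* ℂ) (H : Matrix (Fin 3) (Fin 3) L) (T : GL (Fin 3) ℂ)
        (hT : (T : Matrix (Fin 3) (Fin 3) ℂ)ᴴ * H.map ι * (T : Matrix (Fin 3) (Fin 3) ℂ) = Literature.Geometry.ComplexHyperbolic.BallModel.J),
        (∀ τ' : L →+* ℂ, InfinitePlace.mk τ' ≠ InfinitePlace.mk ι → (H.map τ').PosDef) → 2 ≤ Module.finrank ℚ ↥(maximalRealSubfield L) →
        ∀ {n' : ℕ} (e₁ : Fin 3 × Fin 1 ≃ Fin n') (dV : Fin 3 → L) (hdV : ∀ i, IsCMField.complexConj L (dV i) = dV i)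
          (hdV0 : ∀ i, dV i ≠ 0) (g : GL (Fin 3) L)
          (hg : ((g : Matrix (Fin 3) (Fin 3) L).map (cmConjRingHom L))ᵀ * H * (g : Matrix (Fin 3) (Fin 3) L) = Matrix.diagonal dV)
          (ιV : finAdelic (↥(maximalRealSubfield L)) L (IsCMField.complexConj L) 3 H →*
              finAdelic (↥(maximalRealSubfield L)) L (IsCMField.complexConj L) 3 (Matrix.diagonal dV)),
            (∀ k, ((ιV k : finAdelic (↥(maximalRealSubfield L)) L (IsCMField.complexConj L) 3 (Matrix.diagonal dV)) :
                GL (Fin 3) (FiniteAdeleRing (𝓞 L) L)) =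
              (toFinAdeleGL L 3 g)⁻¹ * (k : GL (Fin 3) (FiniteAdeleRing (𝓞 L) L)) * toFinAdeleGL L 3 g) →
            ∀ (μA : Measure (adelicGroupData (↥(maximalRealSubfield L)) L (IsCMField.complexConj L) 3 H).automorphicQuotient)
              [(adelicGroupData (↥(maximalRealSubfield L)) L (IsCMField.complexConj L) 3 H).IsAutomorphicMeasure μA],
              ∀ P : DiscreteAutomorphicRep (adelicGroupData (↥(maximalRealSubfield L)) L (IsCMField.complexConj L) 3 H) μA,
                (P.IsHolCotangentAt (cmArchSection L ι H T hT) (cmCompactFactor L ι H T hT) ∨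
                  P.IsAntiholCotangentAt (cmArchSection L ι H T hT) (cmCompactFactor L ι H T hT)) →
                ∀ (μ : Literature.NumberTheory.Automorphic.IdeleClassGroup L →ₜ* Circle) (hμ : IsConjugateSymplectic L μ), HasWeight L μ 1 →
                  ∀ (a : (↥(maximalRealSubfield L))ˣ) (χ : Chi (↥(maximalRealSubfield L)) L (IsCMField.complexConj L)),
                    P.HasFinComponent
                      (rhoAtLine (↥(maximalRealSubfield L)) L (IsCMField.complexConj L) 3 e₁ (Matrix.diagonal dV)
                        (complexConj_imagUnit L) (imagUnit_ne_zero L) (imagUnit_mul_self L) (realDiagonal_isSymm L dV hdV)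
                        (isUnit_det_realDiagonal L dV hdV hdV0) (realDiagonal_map L dV hdV).symm
                        (fun a => isCompatible_chiSplittingLine L e₁ dV hdV hdV0 (toHeckeCharacter L μ)
                          (isUnitary_toHeckeCharacter L μ) ((isOscillatorChar_toHeckeCharacter_iff μ).mpr hμ)
                          (TW (↥(maximalRealSubfield L)) a) (isSymm_TW (↥(maximalRealSubfield L)) a)
                          (isUnit_det_TW (↥(maximalRealSubfield L)) a) (JW (↥(maximalRealSubfield L)) L a)
                          (JW_eq (↥(maximalRealSubfield L)) L a)) ιV a χ) →
                      Even ({v : HeightOneSpectrum (𝓞 ↥(maximalRealSubfield L)) |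
                              locF (↥(maximalRealSubfield L)) (imagUnitSq L) a v ≠ 1}.ncard +
                        {φ : L →+* ℂ | φ ∈ hμ.cmType.1 ∧ 0 < (φ (2 * imagUnit L)⁻¹).im}.ncard)
    ) :
    Summit.HodgeConjecture.HodgeConjecture.Theses.HCCMUnconditional.F0HdictE := by
  delta Summit.HodgeConjecture.HodgeConjecture.Theses.HCCMUnconditional.F0HdictE
    Summit.HodgeConjecture.HodgeConjecture.Theorems.F0FloorSockets.HdictEType
  exact
    oscillatorTriple_dictionaryExistence_holds_of TowerRealisation.stubU1RealisationAt_holds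
      (P2StubU2OfLettersCadmD.stub_U2_cohFormsSpectrumIsThetaAt_of_Cadm_D
        (F0P2cSocketC.cohFinComponentIsThetaAdm_of_CE
          (F0P2eCEOfRung2.stubCE_of_PK_GL_LW_LR_LTpu
            (F0P2gPKOfRung3.stubPK_of_PKPi (F0P2jPKPiOfLetters.pkPi_of_letters hS2 hGR hD7))
            F0P2eStubGLGlobalLine.stubGL_holds F0P2eStubLWLocalWitness.stubLW_holds
            F0P2eStubLRLocalReindex.stubLR_holds F0P2eStubLTLocalTypeTransport.stubLT_prodUnique_holds))
        F0P2dSocketD.holCotFormSpectralProjection_holds)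
      (F0P2fE3OfRung2.stubU4_of_E3flat hE)

set_option synthInstance.maxHeartbeats 400000 in
set_option maxHeartbeats 16000000 in
/-- **THE CRUX `HCCMUnconditional.H413` (stmt-HodgeConjecture-24833) BY NAME MODULO EXACTLY THE FOUR P2 LETTERS {S2♯ = `cohDiscrete_memXiFamily_archPinned`, GR91N, D7α, E3♭} AND P3's SOCKET 27456 `F0HJ3a`**
(socket 27457 `F0Hocc` ★ p814762 discharged inside ★ `HCCMUnconditionalH413OfF0.H413_of_F0HdictE_F0HJ3a`).  HC_CM is proved only modulo the printed citations until rung 0 closes.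
[cite: Liu2021, Prop. 4.13, proof l. 2145] [cite: GelbartRogawski1991, Thm 5.1.1] [cite: Rogawski1990, Thm. 13.3.1, Thm 13.3.6 (c)] [cite: Rogawski1992, Thm 1.1] [cite: Li1992, Thm 2.1] -/
theorem H413_of_letters
    (hS2 : Literature.NumberTheory.Rogawski1990.cohDiscrete_memXiFamily_archPinned)
    (hGR : Literature.NumberTheory.GelbartRogawski1991.GR91Lemma512NonsplitAsPrinted)
    (hD7 : Literature.NumberTheory.GelbartRogawski1991.xiEnvelope_nonsplit_isThetaType)
    (hE :
      ∀ (L : Type) [Field L] [NumberField L] [IsCMField L] (ι : L →+* ℂ) (H : Matrix (Fin 3) (Fin 3) L) (T : GL (Fin 3) ℂ)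
        (hT : (T : Matrix (Fin 3) (Fin 3) ℂ)ᴴ * H.map ι * (T : Matrix (Fin 3) (Fin 3) ℂ) = Literature.Geometry.ComplexHyperbolic.BallModel.J),
        (∀ τ' : L →+* ℂ, InfinitePlace.mk τ' ≠ InfinitePlace.mk ι → (H.map τ').PosDef) → 2 ≤ Module.finrank ℚ ↥(maximalRealSubfield L) →
        ∀ {n' : ℕ} (e₁ : Fin 3 × Fin 1 ≃ Fin n') (dV : Fin 3 → L) (hdV : ∀ i, IsCMField.complexConj L (dV i) = dV i)
          (hdV0 : ∀ i, dV i ≠ 0) (g : GL (Fin 3) L)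
          (hg : ((g : Matrix (Fin 3) (Fin 3) L).map (cmConjRingHom L))ᵀ * H * (g : Matrix (Fin 3) (Fin 3) L) = Matrix.diagonal dV)
          (ιV : finAdelic (↥(maximalRealSubfield L)) L (IsCMField.complexConj L) 3 H →*
              finAdelic (↥(maximalRealSubfield L)) L (IsCMField.complexConj L) 3 (Matrix.diagonal dV)),
            (∀ k, ((ιV k : finAdelic (↥(maximalRealSubfield L)) L (IsCMField.complexConj L) 3 (Matrix.diagonal dV)) :
                GL (Fin 3) (FiniteAdeleRing (𝓞 L) L)) =
              (toFinAdeleGL L 3 g)⁻¹ * (k : GL (Fin 3) (FiniteAdeleRing (𝓞 L) L)) * toFinAdeleGL L 3 g) →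
            ∀ (μA : Measure (adelicGroupData (↥(maximalRealSubfield L)) L (IsCMField.complexConj L) 3 H).automorphicQuotient)
              [(adelicGroupData (↥(maximalRealSubfield L)) L (IsCMField.complexConj L) 3 H).IsAutomorphicMeasure μA],
              ∀ P : DiscreteAutomorphicRep (adelicGroupData (↥(maximalRealSubfield L)) L (IsCMField.complexConj L) 3 H) μA,
                (P.IsHolCotangentAt (cmArchSection L ι H T hT) (cmCompactFactor L ι H T hT) ∨
                  P.IsAntiholCotangentAt (cmArchSection L ι H T hT) (cmCompactFactor L ι H T hT)) →
                ∀ (μ : Literature.NumberTheory.Automorphic.IdeleClassGroup L →ₜ* Circle) (hμ : IsConjugateSymplectic L μ), HasWeight L μ 1 →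
                  ∀ (a : (↥(maximalRealSubfield L))ˣ) (χ : Chi (↥(maximalRealSubfield L)) L (IsCMField.complexConj L)),
                    P.HasFinComponent
                      (rhoAtLine (↥(maximalRealSubfield L)) L (IsCMField.complexConj L) 3 e₁ (Matrix.diagonal dV)
                        (complexConj_imagUnit L) (imagUnit_ne_zero L) (imagUnit_mul_self L) (realDiagonal_isSymm L dV hdV)
                        (isUnit_det_realDiagonal L dV hdV hdV0) (realDiagonal_map L dV hdV).symm
                        (fun a => isCompatible_chiSplittingLine L e₁ dV hdV hdV0 (toHeckeCharacter L μ)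
                          (isUnitary_toHeckeCharacter L μ) ((isOscillatorChar_toHeckeCharacter_iff μ).mpr hμ)
                          (TW (↥(maximalRealSubfield L)) a) (isSymm_TW (↥(maximalRealSubfield L)) a)
                          (isUnit_det_TW (↥(maximalRealSubfield L)) a) (JW (↥(maximalRealSubfield L)) L a)
                          (JW_eq (↥(maximalRealSubfield L)) L a)) ιV a χ) →
                      Even ({v : HeightOneSpectrum (𝓞 ↥(maximalRealSubfield L)) |
                              locF (↥(maximalRealSubfield L)) (imagUnitSq L) a v ≠ 1}.ncard +
                        {φ : L →+* ℂ | φ ∈ hμ.cmType.1 ∧ 0 < (φ (2 * imagUnit L)⁻¹).im}.ncard)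
    )
    (hJ3a : Summit.HodgeConjecture.HodgeConjecture.Theses.HCCMUnconditional.F0HJ3a) :
    Summit.HodgeConjecture.HodgeConjecture.Theses.HCCMUnconditional.H413 :=
  Summit.HodgeConjecture.HodgeConjecture.Theorems.HCCMUnconditionalH413OfF0.H413_of_F0HdictE_F0HJ3a
    (hdictE_of_letters hS2 hGR hD7 hE) hJ3a

end Summit.HodgeConjecture.HodgeConjecture.Cruxes.H413.F0P2kHdictEOfFourLetters

end
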